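import Summits.CriticalPhenomena.Ising3DConformalLimit.Theorems.EnergyNotSigmaSquaredMoebiusLimitExistsOneMapOneJetDefs
import Mathlib.Analysis.Analytic.Uniqueness
import Mathlib.Analysis.Analytic.Constructions
import Mathlib.Analysis.Analytic.Linear
import Mathlib.Analysis.SpecialFunctions.Complex.Analytic
import Mathlib.Analysis.SpecialFunctions.ExpDeriv
import Mathlib.Topology.Connected.PathConnected
import HarnessLib

/-!
# Line `one-map-one-jet` for crux `MoebiusLimitExists` (stmt-CriticalPhenomena-1344) —
stub 4: the one-point jet reduction (`stub_onePointJetReduction`)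

For a family `S : CorrFamily 3` normalised off `NonCoincident`, continuous on it and real-analytic on
the good configurations `GoodConfig n`: if every doubly-good configuration `x ∈ InvGoodConfig n` is
joined INSIDE `InvGoodConfig n` to a point `x₀` at which the inversion defect
`D_n = inversionDefect Δ S n` has vanishing germ, then `S` is inversion covariant
(`IsInversionCovariant Δ S`, i.e. `D_n = 0` off the pole, `isInversionCovariant_iff_inversionDefect`).

Proof. (1) `D_n` is real-analytic at every point of `InvGoodConfig n`: `S n` is analytic at `x` and at
`ι x` (both good), `ι = invCfg` is analytic off the pole (`p ↦ (‖p‖²)⁻¹ • p` coordinatewise, `‖p‖²` a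
quadratic polynomial), and the weight `∏ ‖y i‖^{2Δ} = ∏ (‖y i‖²)^Δ` is analytic where all `y i ≠ 0`
(`t ↦ t^Δ = exp (Δ log t)` near `t > 0`). (2) Identity theorem along the joining path: the range of the
path is preconnected, lies in `InvGoodConfig n`, contains `x₀` (germ zero) and `x`, so `D_n x = 0`
(`AnalyticOnNhd.eqOn_zero_of_preconnected_of_eventuallyEq_zero`). (3) Density + continuity: `D_n` is
continuous at every punctured non-coincident configuration and `PuncturedNonCoincident n ⊆ closure
(InvGoodConfig n)`, so `D_n = 0` there (`ContinuousWithinAt.mem_closure`). (4) At a punctured COINCIDENT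
configuration both `S n x` and `S n (ι x)` vanish by normalisation (`ι` preserves non-coincidence).

References: Di Francesco–Mathieu–Sénéchal 1997 §4.1, §4.3.1 (tree
`Literature.Probability.LatticeModels.ConformalCovariance`); the identity principle for real-analytic
maps (Mathlib `Mathlib.Analysis.Analytic.Uniqueness`).
-/

open Set Function Filter EuclideanGeometry
open scoped Topology
open Literature.Probability.LatticeModels

namespace Summit.CriticalPhenomena.Ising3DConformalLimit.MoebiusLimitExistsOneMapOneJet

/-! ### Real-analyticity of the ingredients of the inversion defect -/

/-- The squared Euclidean norm `v ↦ ‖v‖² = ∑ₐ vₐ²` of `ℝ³` is real-analytic (a quadratic polynomial).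
[folklore] -/
theorem analyticAt_norm_sq (v : EuclideanSpace ℝ (Fin 3)) :
    AnalyticAt ℝ (fun w : EuclideanSpace ℝ (Fin 3) => ‖w‖ ^ 2) v := by
  have h : (fun w : EuclideanSpace ℝ (Fin 3) => ‖w‖ ^ 2) =
      fun w => ∑ a, (EuclideanSpace.proj (𝕜 := ℝ) a w) ^ 2 := by
    funext w
    rw [EuclideanSpace.real_norm_sq_eq]
    rfl
  rw [h]
  exact Finset.analyticAt_fun_sum _
    (fun a _ => ((EuclideanSpace.proj (𝕜 := ℝ) a).analyticAt v).fun_pow 2)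

/-- The pointwise unit inversion `ι = invCfg` is real-analytic at every configuration avoiding the pole:
coordinatewise `p ↦ (‖p‖²)⁻¹ • p` with `‖p‖² ≠ 0`. [cite: FrancescoMathieuSenechal1997, §4.1 eq. (4.15)] -/
theorem analyticAt_invCfg {n : ℕ} {x : Fin n → EuclideanSpace ℝ (Fin 3)} (hx : ∀ i, x i ≠ 0) :
    AnalyticAt ℝ (invCfg (n := n)) x := by
  have h : (invCfg (n := n)) = fun y i => (‖y i‖ ^ 2)⁻¹ • y i := by
    funext y i
    rw [invCfg_apply, inversion_zero_one_eq_smul]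
  rw [h]
  refine AnalyticAt.pi (f := fun i (y : Fin n → EuclideanSpace ℝ (Fin 3)) => (‖y i‖ ^ 2)⁻¹ • y i)
    (fun i => ?_)
  have hproj : AnalyticAt ℝ (fun y : Fin n → EuclideanSpace ℝ (Fin 3) => y i) x :=
    (ContinuousLinearMap.proj (R := ℝ)
      (φ := fun _ : Fin n => EuclideanSpace ℝ (Fin 3)) i).analyticAt x
  have hsq : AnalyticAt ℝ (fun y : Fin n → EuclideanSpace ℝ (Fin 3) => ‖y i‖ ^ 2) x :=
    (analyticAt_norm_sq (x i)).comp_of_eq hproj rfl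
  have hne : ‖x i‖ ^ 2 ≠ 0 := pow_ne_zero 2 (norm_ne_zero_iff.2 (hx i))
  exact (hsq.fun_inv hne).fun_smul hproj

/-- The real power `t ↦ t ^ p` is real-analytic at every `t > 0` (`t ^ p = exp (p log t)` near `t`).
[folklore] -/
theorem analyticAt_rpow_const_of_pos {t : ℝ} (ht : 0 < t) (p : ℝ) :
    AnalyticAt ℝ (fun s : ℝ => s ^ p) t := by
  have h : (fun s : ℝ => Real.exp (Real.log s * p)) =ᶠ[𝓝 t] fun s => s ^ p := by
    filter_upwards [lt_mem_nhds ht] with s hs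
    rw [Real.rpow_def_of_pos hs]
  exact (analyticAt_rexp.comp ((analyticAt_log ht).fun_mul analyticAt_const)).congr h

/-- The inversion weight `y ↦ ∏ᵢ ‖y i‖^{2Δ} = ∏ᵢ (‖y i‖²)^Δ` is real-analytic at every configuration
avoiding the pole. [cite: FrancescoMathieuSenechal1997, §4.3.1 eq. (4.62)] -/
theorem analyticAt_normWeight {n : ℕ} {x : Fin n → EuclideanSpace ℝ (Fin 3)} (hx : ∀ i, x i ≠ 0)
    (Δ : ℝ) :
    AnalyticAt ℝ (fun y : Fin n → EuclideanSpace ℝ (Fin 3) => ∏ i, ‖y i‖ ^ (2 * Δ)) x := by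
  have h : (fun y : Fin n → EuclideanSpace ℝ (Fin 3) => ∏ i, ‖y i‖ ^ (2 * Δ)) =
      fun y => ∏ i, (‖y i‖ ^ 2) ^ Δ := by
    funext y
    refine Finset.prod_congr rfl (fun i _ => ?_)
    rw [Real.rpow_mul (norm_nonneg _), Real.rpow_two]
  rw [h]
  refine Finset.analyticAt_fun_prod _ (fun i _ => ?_)
  have hproj : AnalyticAt ℝ (fun y : Fin n → EuclideanSpace ℝ (Fin 3) => y i) x :=
    (ContinuousLinearMap.proj (R := ℝ)
      (φ := fun _ : Fin n => EuclideanSpace ℝ (Fin 3)) i).analyticAt x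
  have hsq : AnalyticAt ℝ (fun y : Fin n → EuclideanSpace ℝ (Fin 3) => ‖y i‖ ^ 2) x :=
    (analyticAt_norm_sq (x i)).comp_of_eq hproj rfl
  have hpos : 0 < ‖x i‖ ^ 2 := pow_pos (norm_pos_iff.2 (hx i)) 2
  exact (analyticAt_rpow_const_of_pos hpos Δ).comp_of_eq hsq rfl

/-- **The inversion defect is real-analytic on the doubly-good set.** For `S n` analytic on
`GoodConfig n`, `D_n = S n ∘ ι − (∏ ‖·‖^{2Δ}) · S n` is analytic at every `x ∈ InvGoodConfig n`
(`x` and `ι x` good, `x` off the pole). [cite: FrancescoMathieuSenechal1997, §4.3.1 eq. (4.62)] -/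
theorem analyticOnNhd_inversionDefect (Δ : ℝ) (S : CorrFamily 3) {n : ℕ}
    (han : AnalyticOnNhd ℝ (S n) (GoodConfig n)) :
    AnalyticOnNhd ℝ (inversionDefect Δ S n) (InvGoodConfig n) := by
  intro x hx
  have h1 : AnalyticAt ℝ (fun y : Fin n → EuclideanSpace ℝ (Fin 3) => S n (invCfg y)) x :=
    (han (invCfg x) hx.2.2).comp (analyticAt_invCfg hx.1)
  have h2 : AnalyticAt ℝ (S n) x := han x hx.2.1
  have h3 := analyticAt_normWeight hx.1 Δ
  show AnalyticAt ℝ (fun y => S n (invCfg y) - (∏ i, ‖y i‖ ^ (2 * Δ)) * S n y) x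
  exact h1.fun_sub (h3.fun_mul h2)

/-! ### The identity theorem along joining paths -/

/-- **Identity theorem, per path-component.** If `S n` is analytic on the good configurations and every
doubly-good `x` is joined inside `InvGoodConfig n` to a point where the inversion defect has vanishing
germ, then the inversion defect vanishes on all of `InvGoodConfig n`: the range of a joining path is
preconnected, lies in the analyticity domain and contains both endpoints. [folklore] -/
theorem inversionDefect_eq_zero_of_mem_invGoodConfig (Δ : ℝ) (S : CorrFamily 3) {n : ℕ}
    (han : AnalyticOnNhd ℝ (S n) (GoodConfig n))
    (hgerm : ∀ x ∈ InvGoodConfig n, ∃ x₀, JoinedIn (InvGoodConfig n) x x₀ ∧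
        inversionDefect Δ S n =ᶠ[𝓝 x₀] 0)
    {x : Fin n → EuclideanSpace ℝ (Fin 3)} (hx : x ∈ InvGoodConfig n) :
    inversionDefect Δ S n x = 0 := by
  obtain ⟨x₀, hJ, hg⟩ := hgerm x hx
  have hsub : Set.range hJ.somePath ⊆ InvGoodConfig n := Set.range_subset_iff.2 hJ.somePath_mem
  have hD : AnalyticOnNhd ℝ (inversionDefect Δ S n) (Set.range hJ.somePath) :=
    (analyticOnNhd_inversionDefect Δ S han).mono hsub
  have hpre : IsPreconnected (Set.range hJ.somePath) := isPreconnected_range hJ.somePath.continuous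
  have h₀ : x₀ ∈ Set.range hJ.somePath := ⟨1, hJ.somePath.target⟩
  have hxU : x ∈ Set.range hJ.somePath := ⟨0, hJ.somePath.source⟩
  exact hD.eqOn_zero_of_preconnected_of_eventuallyEq_zero hpre h₀ hg hxU

/-! ### Continuity of the inversion defect at punctured non-coincident configurations -/

/-- The inversion defect of a family continuous on `NonCoincident` is continuous at every punctured
non-coincident configuration (`S n` continuous at `x` and at `ι x ∈ NonCoincident`, `ι` and the weights
continuous off the pole). [folklore] -/
theorem continuousAt_inversionDefect (Δ : ℝ) (S : CorrFamily 3) {n : ℕ}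
    (hcont : ContinuousOn (S n) (NonCoincident 3 n))
    {x : Fin n → EuclideanSpace ℝ (Fin 3)} (hx : x ∈ PuncturedNonCoincident n) :
    ContinuousAt (inversionDefect Δ S n) x := by
  have hSx : ContinuousAt (S n) x := hcont.continuousAt ((isOpen_nonCoincident 3 n).mem_nhds hx.1)
  have hιx : invCfg x ∈ NonCoincident 3 n := (invCfg_mem_nonCoincident_iff x).2 hx.1
  have hSιx : ContinuousAt (S n) (invCfg x) :=
    hcont.continuousAt ((isOpen_nonCoincident 3 n).mem_nhds hιx)
  have hι : ContinuousAt (invCfg (n := n)) x := (analyticAt_invCfg hx.2).continuousAt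
  have h1 : ContinuousAt (fun y : Fin n → EuclideanSpace ℝ (Fin 3) => S n (invCfg y)) x :=
    ContinuousAt.comp hSιx hι
  have h3 : ContinuousAt (fun y : Fin n → EuclideanSpace ℝ (Fin 3) => ∏ i, ‖y i‖ ^ (2 * Δ)) x :=
    (analyticAt_normWeight hx.2 Δ).continuousAt
  show ContinuousAt (fun y => S n (invCfg y) - (∏ i, ‖y i‖ ^ (2 * Δ)) * S n y) x
  exact h1.sub (h3.mul hSx)

/-- At a punctured non-coincident configuration in the closure of the doubly-good set, a continuous
inversion defect vanishing on the doubly-good set vanishes. [folklore] -/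
theorem inversionDefect_eq_zero_of_mem_closure (Δ : ℝ) (S : CorrFamily 3) {n : ℕ}
    (hcont : ContinuousOn (S n) (NonCoincident 3 n))
    (hzero : ∀ y ∈ InvGoodConfig n, inversionDefect Δ S n y = 0)
    {x : Fin n → EuclideanSpace ℝ (Fin 3)} (hx : x ∈ PuncturedNonCoincident n)
    (hcl : x ∈ closure (InvGoodConfig n)) :
    inversionDefect Δ S n x = 0 := by
  have hcw : ContinuousWithinAt (inversionDefect Δ S n) (InvGoodConfig n) x :=
    (continuousAt_inversionDefect Δ S hcont hx).continuousWithinAt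
  have hmaps : MapsTo (inversionDefect Δ S n) (InvGoodConfig n) {0} :=
    fun y hy => mem_singleton_iff.2 (hzero y hy)
  have hmem := hcw.mem_closure hcl hmaps
  rwa [closure_singleton, mem_singleton_iff] at hmem

/-- At a configuration off the pole but COINCIDENT, the inversion defect of a family normalised off
`NonCoincident` vanishes: both `S n x` and `S n (ι x)` are `0` (`ι` preserves non-coincidence).
[folklore] -/
theorem inversionDefect_eq_zero_of_not_mem_nonCoincident (Δ : ℝ) (S : CorrFamily 3) {n : ℕ}
    (hnorm : ∀ z, z ∉ NonCoincident 3 n → S n z = 0)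
    {x : Fin n → EuclideanSpace ℝ (Fin 3)} (hx : x ∉ NonCoincident 3 n) :
    inversionDefect Δ S n x = 0 := by
  have h1 : S n x = 0 := hnorm x hx
  have h2 : S n (invCfg x) = 0 := hnorm _ (fun h => hx ((invCfg_mem_nonCoincident_iff x).1 h))
  simp only [inversionDefect, h1, h2, mul_zero, sub_zero]

/-! ### The stub -/

/-- **Stub 4 — one-point jet reduction, per path-component.** For a family normalised off
`NonCoincident`, continuous on it and real-analytic on the good configurations: if the punctured
non-coincident configurations lie in the closure of the doubly-good set and every doubly-good
configuration `x` is joined INSIDE `InvGoodConfig n` to a point `x₀` where the inversion defect has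
vanishing germ, the family is inversion covariant. Proof: `D_n` is real-analytic on `InvGoodConfig n`
(`analyticOnNhd_inversionDefect`); the identity theorem along the joining path gives `D_n x = 0`
(`inversionDefect_eq_zero_of_mem_invGoodConfig`); density + continuity extend this to
`PuncturedNonCoincident n` (`inversionDefect_eq_zero_of_mem_closure`); punctured coincident
configurations are handled by normalisation (`inversionDefect_eq_zero_of_not_mem_nonCoincident`); and
`IsInversionCovariant Δ S` IS `D_n = 0` off the pole (`isInversionCovariant_iff_inversionDefect`).
[cite: FrancescoMathieuSenechal1997, §4.3.1 eq. (4.62)] -/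
theorem stub_onePointJetReduction :
    ∀ (Δ : ℝ) (S : CorrFamily 3),
      (∀ n z, z ∉ NonCoincident 3 n → S n z = 0) →
      (∀ n, ContinuousOn (S n) (NonCoincident 3 n)) →
      (∀ n, AnalyticOnNhd ℝ (S n) (GoodConfig n)) →
      (∀ n, PuncturedNonCoincident n ⊆ closure (InvGoodConfig n)) →
      (∀ n, ∀ x ∈ InvGoodConfig n, ∃ x₀, JoinedIn (InvGoodConfig n) x x₀ ∧
        inversionDefect Δ S n =ᶠ[𝓝 x₀] 0) →
      IsInversionCovariant Δ S := by
  intro Δ S hnorm hcont han hdense hgerm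
  rw [isInversionCovariant_iff_inversionDefect]
  intro n x hx
  by_cases hnc : x ∈ NonCoincident 3 n
  · have hxP : x ∈ PuncturedNonCoincident n := ⟨hnc, hx⟩
    exact inversionDefect_eq_zero_of_mem_closure Δ S (hcont n)
      (fun y hy => inversionDefect_eq_zero_of_mem_invGoodConfig Δ S (han n) (hgerm n) hy)
      hxP (hdense n hxP)
  · exact inversionDefect_eq_zero_of_not_mem_nonCoincident Δ S (hnorm n) hnc

end Summit.CriticalPhenomena.Ising3DConformalLimit.MoebiusLimitExistsOneMapOneJet
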